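import Literature.AlgebraicGeometry.Resolution.AlterationsSectionDivisor
import Literature.AlgebraicGeometry.Resolution.BlowupChartMembership
import Literature.AlgebraicGeometry.Resolution.AlterationsInduction
import Literature.AlgebraicGeometry.Resolution.AlterationsBoundarySmoothLocus
import Literature.AlgebraicGeometry.Resolution.ResolutionOfCurves
import Literature.AlgebraicGeometry.Resolution.RegularLocusPerfectField
import Literature.AlgebraicGeometry.Motives.VarietiesDimensionProofs
import Literature.Topology.KrullDimensionDrop
import Literature.AlgebraicGeometry.Resolution.SmoothFibreChart
import Mathlib.RingTheory.KrullDimension.NonZeroDivisors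
import Mathlib.RingTheory.Ideal.KrullsHeightTheorem
import Mathlib.AlgebraicGeometry.Morphisms.FiniteType
import HarnessLib

/-!
# Points of the support of an effective Cartier divisor: local rings of `Z_red`

Topic: `Literature/AlgebraicGeometry/Resolution`. Bookkeeping for the choice of the points
`z ∈ Z` at which the projection of de Jong's Lemma 4.11 is made unramified along `Z` (de Jong
1996, proof of 4.11, p. 68: "`Z → π(Z) → ℙ^{d-1}` is generically étale by construction" /
2.11 (β)): `X` integral of finite type over a field `k` with `dim X = d + 1`, `Z = Supp D` the
support of an effective Cartier divisor, `Z_red` its reduced closed subscheme and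
`I_z ⊆ 𝒪_{X,z}` the stalk of its ideal.

* `DeJong1996.nonempty_quotientStalkIdealEquiv` — **`𝒪_{X,z}/I_z ≅ 𝒪_{Z_red,z'}`** for `z'` the point of
  `Z_red` over `z` (the stalk map of the closed immersion is onto with kernel `I_z`);
* `DeJong1996.le_ringKrullDim_quotient_stalkIdeal` — **`dim 𝒪_{X,z}/I_z ≥ d`** at a closed
  point `z ∈ Z` (Krull: `I_z ⊆ √(t)` for a local equation `t ∈ 𝔪_z` of `D`, and
  `dim 𝒪_{X,z}/(t) ≥ dim 𝒪_{X,z} - 1 = d`);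
* `DeJong1996.ringKrullDim_stalk_reduced_le` — **`dim 𝒪_{Z_red,z'} ≤ d`** (`≤ dim Z < dim X`);
* `DeJong1996.exists_closed_regular_point_of_mem_genericPoints` — **every irreducible component
  of `Z` contains a closed point `z` with `𝒪_{Z_red,z'}` regular** (`k` perfect: the regular locus
  of an affine chart of `Z_red` is open, Matsumura §30, and contains the generic point of the
  component, whose local ring is a field; closed points are dense, `Z_red` being Jacobson).

Everything is proved; no named facts.

## References

* A. J. de Jong, *Smoothness, semi-stability and alterations*, Publ. Math. IHÉS 83 (1996), 2.11
  and proof of Lemma 4.11, p. 68. [DeJong1996]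
* H. Matsumura, *Commutative Ring Theory* (1986), §30 Cor. to Thm. 30.5; Thm. 13.5 (Krull).
  [Matsumura1987]
-/

noncomputable section

open CategoryTheory AlgebraicGeometry TopologicalSpace Topology IsLocalRing Order
open Scheme.IdealSheafData

namespace Literature.AlgebraicGeometry.Resolution

namespace DeJong1996

universe u

variable {X : Scheme.{u}} {Z : Set X} (hZ : IsClosed Z)

/-! ## `𝒪_{X,z}/I_z ≅ 𝒪_{Z_red,z'}` -/

/-- The stalk map of `Z_red ↪ X` at `z'` is onto with kernel the stalk `I_z` of the ideal of `Z`.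
[folklore] -/
theorem ker_stalkMap_subschemeι_vanishingIdeal
    (z' : ↥((vanishingIdeal ⟨Z, hZ⟩ : Scheme.IdealSheafData X).subscheme)) :
    RingHom.ker (((vanishingIdeal ⟨Z, hZ⟩ : Scheme.IdealSheafData X).subschemeι).stalkMap z').hom =
      stalkIdeal (vanishingIdeal ⟨Z, hZ⟩) ((vanishingIdeal ⟨Z, hZ⟩ : Scheme.IdealSheafData X).subschemeι z') := by
  rw [← stalkIdeal_ker_eq_ker_stalkMap, ker_subschemeι]

/-- **`𝒪_{X,z}/I_z ≅ 𝒪_{Z_red,z'}`** for the point `z'` of the reduced closed subscheme `Z_red`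
over `z ∈ Z` (stated as the existence of a ring isomorphism). [folklore] -/
theorem nonempty_quotientStalkIdealEquiv
    (z' : ↥((vanishingIdeal ⟨Z, hZ⟩ : Scheme.IdealSheafData X).subscheme)) {z : X}
    (hz : (vanishingIdeal ⟨Z, hZ⟩ : Scheme.IdealSheafData X).subschemeι z' = z) :
    Nonempty ((X.presheaf.stalk z ⧸ stalkIdeal (vanishingIdeal ⟨Z, hZ⟩) z) ≃+*
      ((vanishingIdeal ⟨Z, hZ⟩ : Scheme.IdealSheafData X).subscheme).presheaf.stalk z') := by
  subst hz
  exact ⟨(Ideal.quotEquivOfEq (ker_stalkMap_subschemeι_vanishingIdeal hZ z').symm).trans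
    (RingHom.quotientKerEquivOfSurjective
      (((vanishingIdeal ⟨Z, hZ⟩ : Scheme.IdealSheafData X).subschemeι).stalkMap_surjective z'))⟩

/-- `dim 𝒪_{Z_red,z'} = dim 𝒪_{X,z}/I_z`. [folklore] -/
theorem ringKrullDim_stalk_reduced_eq
    (z' : ↥((vanishingIdeal ⟨Z, hZ⟩ : Scheme.IdealSheafData X).subscheme)) {z : X}
    (hz : (vanishingIdeal ⟨Z, hZ⟩ : Scheme.IdealSheafData X).subschemeι z' = z) :
    ringKrullDim (((vanishingIdeal ⟨Z, hZ⟩ : Scheme.IdealSheafData X).subscheme).presheaf.stalk z') =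
      ringKrullDim (X.presheaf.stalk z ⧸ stalkIdeal (vanishingIdeal ⟨Z, hZ⟩) z) := by
  obtain ⟨e⟩ := nonempty_quotientStalkIdealEquiv hZ z' hz
  exact (ringKrullDim_eq_of_ringEquiv e).symm

/-- `𝒪_{Z_red,z'}` is regular iff `𝒪_{X,z}/I_z` is. [folklore] -/
theorem isRegularLocalRing_stalk_reduced_iff
    (z' : ↥((vanishingIdeal ⟨Z, hZ⟩ : Scheme.IdealSheafData X).subscheme)) {z : X}
    (hz : (vanishingIdeal ⟨Z, hZ⟩ : Scheme.IdealSheafData X).subschemeι z' = z) :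
    IsRegularLocalRing (((vanishingIdeal ⟨Z, hZ⟩ : Scheme.IdealSheafData X).subscheme).presheaf.stalk z') ↔
      IsRegularLocalRing (X.presheaf.stalk z ⧸ stalkIdeal (vanishingIdeal ⟨Z, hZ⟩) z) := by
  obtain ⟨e⟩ := nonempty_quotientStalkIdealEquiv hZ z' hz
  exact ⟨fun H => @IsRegularLocalRing.of_ringEquiv _ _ H _ _ e.symm,
    fun H => @IsRegularLocalRing.of_ringEquiv _ _ H _ _ e⟩

/-! ## `dim 𝒪_{X,z}/I_z ≥ d` for the support of an effective Cartier divisor -/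

section Divisor

variable {k : Type u} [Field k] [IsIntegral X] (fX : X ⟶ Spec (.of k)) [LocallyOfFiniteType fX]
  {D : X.IdealSheafData} (hD : IsEffectiveCartier D) (hZD : (D.support : Set X) = Z) {d : ℕ}
  (hdim : topologicalKrullDim X = (d + 1 : ℕ))

omit [IsIntegral X] in
include hZD in
/-- `Z = Supp D` as closed subsets. [folklore] -/
theorem closeds_eq_support : (⟨Z, hZ⟩ : Closeds X) = D.support := by
  ext1; exact hZD.symm

omit [IsIntegral X] in
include hD hZD in
/-- **The stalk of the ideal of `Z = Supp D` lies in the radical of a local equation of `D`**: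
`I_z = (√D)_z ⊆ √(t)` for `D_z = (t)`. [folklore] -/
theorem exists_stalkIdeal_vanishingIdeal_le_radical (z : X) :
    ∃ t : X.presheaf.stalk z, stalkIdeal D z = Ideal.span {t} ∧
      stalkIdeal (vanishingIdeal ⟨Z, hZ⟩) z ≤ (Ideal.span {t}).radical := by
  obtain ⟨t, -, ht⟩ := hD.exists_stalkIdeal_eq_span z
  refine ⟨t, ht, ?_⟩
  rw [closeds_eq_support hZ hZD, vanishingIdeal_support, ← ht]
  -- `(√D)_z ⊆ √(D_z)` on an affine neighbourhood
  obtain ⟨U, hU, hzU, -⟩ :=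
    exists_isAffineOpen_mem_and_subset (X := X) (x := z) (U := ⊤) (Opens.mem_top z)
  rw [stalkIdeal_eq_map_germ D.radical ⟨U, hU⟩ hzU, stalkIdeal_eq_map_germ D ⟨U, hU⟩ hzU,
    radical_ideal]
  exact Ideal.map_radical_le (f := (X.presheaf.germ U z hzU).hom) (I := D.ideal ⟨U, hU⟩)

include fX hD hZD hdim in
/-- **`dim 𝒪_{X,z}/I_z ≥ d` at a closed point `z` of `Z = Supp D`** (`X` integral of finite type
over `k`, `dim X = d + 1`): for a local equation `t ∈ 𝔪_z` of `D` one has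
`dim 𝒪_{X,z}/(t) + 1 ≥ dim 𝒪_{X,z} = d + 1` (Krull), and `I_z ⊆ √(t)`.
[cite: Matsumura1987, Thm. 13.5] -/
theorem le_ringKrullDim_quotient_stalkIdeal {z : X} (hzZ : z ∈ Z) (hzc : IsClosed ({z} : Set X)) :
    (d : WithBot ℕ∞) ≤ ringKrullDim (X.presheaf.stalk z ⧸ stalkIdeal (vanishingIdeal ⟨Z, hZ⟩) z) := by
  haveI : IsLocallyNoetherian X := LocallyOfFiniteType.isLocallyNoetherian fX
  obtain ⟨t, ht, hle⟩ := exists_stalkIdeal_vanishingIdeal_le_radical hZ hD hZD z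
  -- `t ∈ 𝔪_z` since `z ∈ Supp D`
  have htm : t ∈ maximalIdeal (X.presheaf.stalk z) := by
    have h1 : z ∈ D.support := by rw [← SetLike.mem_coe, hZD]; exact hzZ
    rw [mem_support_iff_stalkIdeal_le, ht, Ideal.span_singleton_le_iff_mem] at h1
    exact h1
  -- `dim 𝒪_{X,z} = d + 1 ≤ dim 𝒪_{X,z}/(t) + 1`
  have hB : ringKrullDim (X.presheaf.stalk z) = (d + 1 : ℕ) := by
    rw [ringKrullDim_stalk_eq_of_isClosed fX hzc, hdim]
  have hKr := ringKrullDim_le_ringKrullDim_quotient_add_card (R := X.presheaf.stalk z) {t}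
    (by rw [Finset.coe_singleton, Set.singleton_subset_iff, SetLike.mem_coe,
          IsLocalRing.ringJacobson_eq_maximalIdeal]
        exact htm)
  rw [hB, Finset.card_singleton, Finset.coe_singleton, Nat.cast_one] at hKr
  -- `dim 𝒪_{X,z}/(t) = dim 𝒪_{X,z}/√(t) ≤ dim 𝒪_{X,z}/I_z`
  have hrad : ringKrullDim (X.presheaf.stalk z ⧸ Ideal.span {t}) =
      ringKrullDim (X.presheaf.stalk z ⧸ (Ideal.span {t}).radical) := by
    rw [ringKrullDim_quotient, ringKrullDim_quotient, PrimeSpectrum.zeroLocus_radical]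
  have hmono : ringKrullDim (X.presheaf.stalk z ⧸ (Ideal.span {t}).radical) ≤
      ringKrullDim (X.presheaf.stalk z ⧸ stalkIdeal (vanishingIdeal ⟨Z, hZ⟩) z) :=
    ringKrullDim_le_of_surjective (Ideal.Quotient.factor hle) (Ideal.Quotient.factor_surjective hle)
  have hd : (d : WithBot ℕ∞) ≤ ringKrullDim (X.presheaf.stalk z ⧸ Ideal.span {t}) :=
    ENat.WithBot.add_le_add_natCast_right_iff.mp hKr
  exact hd.trans (hrad.le.trans hmono)

end Divisor

/-! ## `dim 𝒪_{Z_red,z'} ≤ dim Z ≤ d` -/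

section UpperBound

variable {d : ℕ} [IsIntegral X] (hdim : topologicalKrullDim X = (d + 1 : ℕ)) (hZX : Z ≠ Set.univ)

include hZ hdim hZX in
/-- `dim Z ≤ d` for a proper closed subset `Z` of the integral `X` of dimension `d + 1`.
[folklore] -/
theorem topologicalKrullDim_le_of_ne_univ : topologicalKrullDim ↥Z ≤ (d : WithBot ℕ∞) :=
  ENat.WithBot.lt_add_one_iff.mp (Literature.Topology.topologicalKrullDim_lt_of_isClosed_ssubset hZ hZX
    (d + 1) (by rw [hdim]; exact_mod_cast Nat.lt_succ_self _))

include hdim hZX in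
/-- **`dim 𝒪_{Z_red,z'} ≤ d`**: the local rings of the reduced closed subscheme on a proper closed
subset `Z` of the integral `X` of dimension `d + 1` have dimension `≤ dim Z ≤ d`. [folklore] -/
theorem ringKrullDim_stalk_reduced_le
    (z' : ↥((vanishingIdeal ⟨Z, hZ⟩ : Scheme.IdealSheafData X).subscheme)) :
    ringKrullDim (((vanishingIdeal ⟨Z, hZ⟩ : Scheme.IdealSheafData X).subscheme).presheaf.stalk z') ≤
      (d : WithBot ℕ∞) := by
  have h1 : ringKrullDim (((vanishingIdeal ⟨Z, hZ⟩ : Scheme.IdealSheafData X).subscheme).presheaf.stalk z') ≤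
      topologicalKrullDim ((vanishingIdeal ⟨Z, hZ⟩ : Scheme.IdealSheafData X).subscheme) := by
    rw [Literature.AlgebraicGeometry.Motives.Scheme.topologicalKrullDim_eq_iSup_ringKrullDim_stalk]
    exact le_iSup (fun x => ringKrullDim
      (((vanishingIdeal ⟨Z, hZ⟩ : Scheme.IdealSheafData X).subscheme).presheaf.stalk x)) z'
  have hemb := ((vanishingIdeal ⟨Z, hZ⟩ : Scheme.IdealSheafData X).subschemeι).isClosedEmbedding
  have h2 : topologicalKrullDim ((vanishingIdeal ⟨Z, hZ⟩ : Scheme.IdealSheafData X).subscheme) =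
      topologicalKrullDim ↥Z := by
    rw [IsHomeomorph.topologicalKrullDim_eq _ hemb.isEmbedding.toHomeomorph.isHomeomorph,
      range_subschemeι_vanishingIdeal]
    rfl
  exact h1.trans (h2.le.trans (topologicalKrullDim_le_of_ne_univ hZ hdim hZX))

end UpperBound

/-! ## A regular closed point on every irreducible component of `Z` -/

section RegularPoint

variable {k : Type u} [Field k] [PerfectField k] (fX : X ⟶ Spec (.of k)) [LocallyOfFiniteType fX]

/-- The point of `Z_red` over a component generic point of `Z` is a component generic point of
`Z_red` (`Z_red → Z` is a homeomorphism). [folklore] -/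
theorem closure_singleton_mem_irreducibleComponents_reduced {η : ↥Z} (hη : η ∈ genericPoints ↥Z)
    {w' : ((vanishingIdeal ⟨Z, hZ⟩ : Scheme.IdealSheafData X).subscheme)} (hw' : ((vanishingIdeal ⟨Z, hZ⟩ : Scheme.IdealSheafData X).subschemeι) w' = (η : X)) : closure {w'} ∈ irreducibleComponents ((vanishingIdeal ⟨Z, hZ⟩ : Scheme.IdealSheafData X).subscheme) := by
  have hemb := ((vanishingIdeal ⟨Z, hZ⟩ : Scheme.IdealSheafData X).subschemeι).isClosedEmbedding.isEmbedding
  let e : ((vanishingIdeal ⟨Z, hZ⟩ : Scheme.IdealSheafData X).subscheme) ≃ₜ ↥Z := hemb.toHomeomorph.trans (Homeomorph.setCongr (range_subschemeι_vanishingIdeal ⟨Z, hZ⟩))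
  have he : ∀ x, (e x : X) = ((vanishingIdeal ⟨Z, hZ⟩ : Scheme.IdealSheafData X).subschemeι) x := fun x => rfl
  have heη : e w' = η := Subtype.ext (by rw [he, hw'])
  have h1 : e ⁻¹' closure {η} = closure {w'} := by
    rw [e.preimage_closure, ← heη, ← Set.image_singleton, e.preimage_image]
  rw [← h1]
  exact preimage_mem_irreducibleComponents hη e.isOpenEmbedding
    ⟨η, subset_closure rfl, ⟨w', heη⟩⟩

omit [PerfectField k] in
/-- The local ring of `Z_red` at a component generic point is a field. [folklore] -/
theorem isField_stalk_reduced_of_mem_genericPoints {η : ↥Z} (hη : η ∈ genericPoints ↥Z)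
    {w' : ((vanishingIdeal ⟨Z, hZ⟩ : Scheme.IdealSheafData X).subscheme)} (hw' : ((vanishingIdeal ⟨Z, hZ⟩ : Scheme.IdealSheafData X).subschemeι) w' = (η : X)) : IsField (((vanishingIdeal ⟨Z, hZ⟩ : Scheme.IdealSheafData X).subscheme).presheaf.stalk w') := by
  haveI : IsReduced ((vanishingIdeal ⟨Z, hZ⟩ : Scheme.IdealSheafData X).subscheme) := isReduced_subscheme_vanishingIdeal ⟨Z, hZ⟩
  exact isField_stalk_of_closure_mem_irreducibleComponents ((vanishingIdeal ⟨Z, hZ⟩ : Scheme.IdealSheafData X).subscheme) w'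
    (closure_singleton_mem_irreducibleComponents_reduced hZ hη hw')

include fX in
/-- **Every irreducible component of `Z` contains a closed point at which `Z_red` is regular**
(`k` perfect, `X` of finite type over `k`): given a generic point `w` of a component of `Z`, there
is a closed point `z ∈ Z` with `w ⤳ z` and `𝒪_{X,z}/I_z ≅ 𝒪_{Z_red,z'}` a regular local ring. On
an affine chart `V = Spec B ∋ w'` of `Z_red`, `B` is of finite type over `k`, its regular locus is
open (Matsumura §30) and contains the prime of `w'` (`𝒪_{Z_red,w'}` is a field), so the locally
closed `Reg(B) ∩ V(𝔭_{w'})` contains a closed point (`Spec B` is Jacobson).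
[cite: Matsumura1987, §30 Cor. to Thm. 30.5] [cite: DeJong1996, 2.11] -/
theorem exists_closed_regular_point_of_mem_genericPoints {w : X}
    (hw : w ∈ Subtype.val '' genericPoints ↥Z) :
    ∃ z ∈ Z, w ⤳ z ∧ IsClosed ({z} : Set X) ∧
      IsRegularLocalRing (X.presheaf.stalk z ⧸ stalkIdeal (vanishingIdeal ⟨Z, hZ⟩) z) := by
  obtain ⟨η, hη, rfl⟩ := hw
  obtain ⟨w', hw'⟩ : (η : X) ∈ Set.range ((vanishingIdeal ⟨Z, hZ⟩ : Scheme.IdealSheafData X).subschemeι) := by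
    rw [range_subschemeι_vanishingIdeal]; exact η.2
  haveI : JacobsonSpace ((vanishingIdeal ⟨Z, hZ⟩ : Scheme.IdealSheafData X).subscheme) := LocallyOfFiniteType.jacobsonSpace (Y := Spec (.of k)) (((vanishingIdeal ⟨Z, hZ⟩ : Scheme.IdealSheafData X).subschemeι) ≫ fX)
  -- an affine chart `V = Spec B ∋ w'`, of finite type over `k`
  obtain ⟨V, hV, hw'V, -⟩ :=
    exists_isAffineOpen_mem_and_subset (X := ((vanishingIdeal ⟨Z, hZ⟩ : Scheme.IdealSheafData X).subscheme)) (x := w') (U := ⊤) (Opens.mem_top w')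
  let ιk : k →+* Γ(Spec (CommRingCat.of k), ⊤) := (Scheme.ΓSpecIso (CommRingCat.of k)).inv.hom
  letI : Algebra k Γ(((vanishingIdeal ⟨Z, hZ⟩ : Scheme.IdealSheafData X).subscheme), V) := (((((vanishingIdeal ⟨Z, hZ⟩ : Scheme.IdealSheafData X).subschemeι) ≫ fX).appLE ⊤ V le_top).hom.comp ιk).toAlgebra
  haveI : Algebra.FiniteType k Γ(((vanishingIdeal ⟨Z, hZ⟩ : Scheme.IdealSheafData X).subscheme), V) := by
    have h1 : ((((vanishingIdeal ⟨Z, hZ⟩ : Scheme.IdealSheafData X).subschemeι) ≫ fX).appLE ⊤ V le_top).hom.FiniteType :=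
      (((vanishingIdeal ⟨Z, hZ⟩ : Scheme.IdealSheafData X).subschemeι) ≫ fX).finiteType_appLE (isAffineOpen_top _) hV le_top
    have h2 : ιk.FiniteType :=
      RingHom.FiniteType.of_surjective _
        (Scheme.ΓSpecIso (CommRingCat.of k)).symm.commRingCatIsoToRingEquiv.surjective
    exact h1.comp h2
  haveI : IsJacobsonRing Γ(((vanishingIdeal ⟨Z, hZ⟩ : Scheme.IdealSheafData X).subscheme), V) := isJacobsonRing_of_finiteType (A := k)
  -- the prime `𝔭` of `w'` is a regular point: `B_𝔭 ≅ 𝒪_{Z_red,w'}` is a field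
  set 𝔭 := hV.primeIdealOf ⟨w', hw'V⟩ with h𝔭
  have h𝔭reg : 𝔭 ∈ regularLocus Γ(((vanishingIdeal ⟨Z, hZ⟩ : Scheme.IdealSheafData X).subscheme), V) := by
    letI := TopCat.Presheaf.algebra_section_stalk ((vanishingIdeal ⟨Z, hZ⟩ : Scheme.IdealSheafData X).subscheme).presheaf (⟨w', hw'V⟩ : V)
    haveI : IsLocalization.AtPrime (((vanishingIdeal ⟨Z, hZ⟩ : Scheme.IdealSheafData X).subscheme).presheaf.stalk w') 𝔭.asIdeal := hV.isLocalization_stalk ⟨w', hw'V⟩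
    have hF := isField_stalk_reduced_of_mem_genericPoints hZ hη hw'
    letI := hF.toField
    have e : Localization.AtPrime 𝔭.asIdeal ≃+* ((vanishingIdeal ⟨Z, hZ⟩ : Scheme.IdealSheafData X).subscheme).presheaf.stalk w' :=
      (IsLocalization.algEquiv 𝔭.asIdeal.primeCompl (Localization.AtPrime 𝔭.asIdeal)
        (((vanishingIdeal ⟨Z, hZ⟩ : Scheme.IdealSheafData X).subscheme).presheaf.stalk w')).toRingEquiv
    exact @IsRegularLocalRing.of_ringEquiv _ _ (inferInstance : IsRegularLocalRing (((vanishingIdeal ⟨Z, hZ⟩ : Scheme.IdealSheafData X).subscheme).presheaf.stalk w'))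
      _ _ e.symm
  -- a closed point `𝔫` of the locally closed `Reg(B) ∩ V(𝔭)`
  have hopen : IsOpen (regularLocus Γ(((vanishingIdeal ⟨Z, hZ⟩ : Scheme.IdealSheafData X).subscheme), V)) := isOpen_regularLocus_of_perfectField k _
  obtain ⟨𝔫, ⟨h𝔫reg, h𝔭𝔫⟩, h𝔫cl⟩ := nonempty_inter_closedPoints
    (Z := regularLocus Γ(((vanishingIdeal ⟨Z, hZ⟩ : Scheme.IdealSheafData X).subscheme), V) ∩ PrimeSpectrum.zeroLocus (𝔭.asIdeal : Set Γ(((vanishingIdeal ⟨Z, hZ⟩ : Scheme.IdealSheafData X).subscheme), V)))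
    ⟨𝔭, h𝔭reg, fun f hf => hf⟩
    (hopen.isLocallyClosed.inter (PrimeSpectrum.isClosed_zeroLocus _).isLocallyClosed)
  have h𝔫max : 𝔫.asIdeal.IsMaximal :=
    (PrimeSpectrum.isClosed_singleton_iff_isMaximal 𝔫).mp h𝔫cl
  have h𝔭le : 𝔭 ≤ 𝔫 := fun f hf => h𝔭𝔫 hf
  -- the points `z' = fromSpec 𝔫 ∈ Z_red` and `z = ι z' ∈ Z`
  have hz'V : hV.fromSpec 𝔫 ∈ V := by
    change hV.fromSpec 𝔫 ∈ (V : Set ((vanishingIdeal ⟨Z, hZ⟩ : Scheme.IdealSheafData X).subscheme))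
    rw [← hV.range_fromSpec]; exact ⟨𝔫, rfl⟩
  have hz'c : IsClosed ({hV.fromSpec 𝔫} : Set ((vanishingIdeal ⟨Z, hZ⟩ : Scheme.IdealSheafData X).subscheme)) :=
    isClosed_singleton_fromSpec_of_isMaximal hV 𝔫 h𝔫max
  refine ⟨((vanishingIdeal ⟨Z, hZ⟩ : Scheme.IdealSheafData X).subschemeι) (hV.fromSpec 𝔫), mem_of_subscheme_vanishingIdeal ⟨Z, hZ⟩ _, ?_, ?_, ?_⟩
  · -- `w = ι w' ⤳ ι z'`
    rw [← hw']
    refine Specializes.map ?_ ((vanishingIdeal ⟨Z, hZ⟩ : Scheme.IdealSheafData X).subschemeι).continuous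
    have h1 : hV.fromSpec 𝔭 ⤳ hV.fromSpec 𝔫 :=
      ((PrimeSpectrum.le_iff_specializes 𝔭 𝔫).mp h𝔭le).map hV.fromSpec.continuous
    rwa [h𝔭, hV.fromSpec_primeIdealOf ⟨w', hw'V⟩] at h1
  · have := ((vanishingIdeal ⟨Z, hZ⟩ : Scheme.IdealSheafData X).subschemeι).isClosedEmbedding.isClosedMap _ hz'c
    rwa [Set.image_singleton] at this
  · -- `𝒪_{X,z}/I_z ≅ 𝒪_{Z_red,z'} ≅ B_𝔫` is regular
    rw [← isRegularLocalRing_stalk_reduced_iff hZ (hV.fromSpec 𝔫) rfl]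
    letI := TopCat.Presheaf.algebra_section_stalk ((vanishingIdeal ⟨Z, hZ⟩ : Scheme.IdealSheafData X).subscheme).presheaf (⟨hV.fromSpec 𝔫, hz'V⟩ : V)
    haveI : IsLocalization.AtPrime (((vanishingIdeal ⟨Z, hZ⟩ : Scheme.IdealSheafData X).subscheme).presheaf.stalk (hV.fromSpec 𝔫)) 𝔫.asIdeal :=
      hV.isLocalization_stalk' 𝔫 hz'V
    have e : Localization.AtPrime 𝔫.asIdeal ≃+* ((vanishingIdeal ⟨Z, hZ⟩ : Scheme.IdealSheafData X).subscheme).presheaf.stalk (hV.fromSpec 𝔫) :=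
      (IsLocalization.algEquiv 𝔫.asIdeal.primeCompl (Localization.AtPrime 𝔫.asIdeal)
        (((vanishingIdeal ⟨Z, hZ⟩ : Scheme.IdealSheafData X).subscheme).presheaf.stalk (hV.fromSpec 𝔫))).toRingEquiv
    exact @IsRegularLocalRing.of_ringEquiv _ _ h𝔫reg _ _ e

end RegularPoint


end DeJong1996

end Literature.AlgebraicGeometry.Resolution

end
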